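import Literature.NumberTheory.Automorphic.GLnComplexCasimirTensor
import Literature.NumberTheory.Automorphic.GKCohomologyCasimir
import Literature.NumberTheory.Automorphic.HarishChandraGLParameterOfCharacter
import Literature.NumberTheory.Automorphic.ArchEmbeddingExtension
import Literature.NumberTheory.Automorphic.AdelicGLnGlue
import HarnessLib

/-!
# The factor `𝔤𝔩ₙ(ℂ) = 𝔤𝔩ₙ(K_w)` of `Lie(GLₙ(K_∞))` at a complex place: its Casimir tensors and the
# scalars of `C_±`, `Z(u)` on the factors of a non-vanishing `(𝔤, K_∞)`-cohomology group

Topic `NumberTheory/Automorphic`; continues `GLnComplexCasimirTensor` (the canonical tensors of the real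
trace forms `B_±` on `𝔤𝔩ₙ(ℂ)`, `C_± =` their Casimir elements) and `GKCohomologyCasimir` (Casimir-type
operators of invariant tensors act on `H^q(𝔤, K; V ⊗ W)` compatibly with both factors).  For a number
field `K`, `G_∞ = GLₙ(K_∞) =` `archGroupGL n K` and a complex place `w`:

* `ComplexPlace.placeLie n w = φ_w : 𝔤𝔩ₙ(ℂ) →ₗ⁅ℝ⁆ 𝔤` — the factor inclusion (`complexPlaceLie` followed by
  `⊤ ≅ 𝔤𝔩ₙ(K_∞)`, the form entering `HasArchParameter`; `comp_comp_complexPlaceLie`), with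
  `mul_complexPlaceLie` / `complexPlaceLie_mul` (`M φ_w(Y) = φ_w(M_w Y)`), **`lie_placeLie`**
  (`[X, φ_w Y] = φ_w [X_w, Y]`), `evalGL n w : GLₙ(K_∞) → GLₙ(ℂ)` and **`Ad_placeLie`**
  (`Ad(g) φ_w Y = φ_w (g_w Y g_w⁻¹)`); the section `placeGL n w : GLₙ(ℂ) → G_∞` (`g` at `w`, `1` at the
  other places: `placeMat_mul`, `evalGL_placeGL`, **`Ad_placeGL_placeLie`** `Ad(ι_w g) φ_w Y = φ_w(g Y g⁻¹)`);
* the families `yB = φ_w(b_x)`, `yRe = φ_w(b_x^∨)` (`B₊`-duals), `yIm` (`B₋`-duals) and the three inputs of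
  `GKCohomologyCasimir`: `𝔤`-invariance (`sum_lie_yB_tmul_yRe/yIm`), `Ad(G_∞)`-invariance
  (`sum_Ad_yB_tmul_Ad_yRe/yIm`), symmetry (`sum_yRe/yIm_tmul_yB`) — pushed forward from `𝔤𝔩ₙ(ℂ)` along
  `φ_w ⊗ φ_w`;
* `op_yB_yRe`, `op_yB_yIm`: `∑_x ρ(φ_w b_x) ρ(φ_w b_x^∨) = ρ_w(C_±)`, `ρ_w = ρ ∘ φ_w`; the central elements
  `zed n w u = φ_w(u · 1)` (`zed_lie`, `Ad_zed`, `rho_zed : ρ(Z_w(u)) = ρ_w(Z(u))`); restriction of a central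
  character to the factor (`exists_hasCentralCharacter_comp_placeLie`,
  `exists_lift_eq_smul_of_hasCentralCharacter`, via `lift_complexPlaceLie_mem_center`);
* **`casPlus_scalar_eq_of_cohomology_ne_zero`, `casMinus_scalar_eq_of_cohomology_ne_zero`,
  `zedU_scalar_add_eq_zero_of_cohomology_ne_zero`**: for `(𝔤, K_∞)`-modules `V`, `W` of `G_∞` with
  `H^q(𝔤, K_∞; V ⊗ W) ≠ 0`, if `C₊,w` (resp. `C₋,w`) acts on `V` by `c` and on `W` by `c'` then `c = c'`,
  and if `Z_w(u)` acts by `c`, `c'` then `c + c' = 0` — the quadratic/central part of Wigner's lemma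
  (Borel–Wallach I §4.1, §5.3) for the factor at `w`, proved from the Casimir homotopy.

Definitions with bodies (`placeLie`, `placeLin`, `evalGL`, `placeGL`, `yB`, `yRe`, `yIm`, `zed`) and theorems;
no named fact.

## References

* A. Borel, N. Wallach, *Continuous cohomology, discrete subgroups, and representations of reductive
  groups*, 2nd ed. (2000), I §4.1, §5.3. [BorelWallach2000]
* A. W. Knapp, *Lie Groups Beyond an Introduction*, 2nd ed. (2002), §V.4 (Prop. 5.24), §V.5 (Thm. 5.44).
  [Knapp2002]
* L. Clozel, *Motifs et formes automorphes* (1990), §3.3. [Clozel1990]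
-/

noncomputable section

-- Mathlib idiom (Mathlib/Algebra/Lie/OfAssociative.lean), as in `GKModules` / `HarishChandraGL`: commutator
-- brackets on matrix algebras and on `Module.End`.
attribute [local instance 100] LieRing.ofAssociativeRing

open scoped Matrix ComplexConjugate TensorProduct
open Complex UniversalEnvelopingAlgebra

namespace Literature.NumberTheory.Automorphic

namespace ComplexPlace

open scoped Classical
open _root_.NumberField _root_.NumberField.InfinitePlace _root_.NumberField.mixedEmbedding GLnComplexCasimir

variable {K : Type} [Field K] [NumberField K] (n : ℕ) (w : {w : InfinitePlace K // IsComplex w})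

/-- `𝔤𝔩ₙ(K_∞) ≅ ⊤ ≤ 𝔤𝔩ₙ(K_∞)`, the presentation of the Lie algebra of `archGroupGL n K`
(inverse of Mathlib's `LieSubalgebra.topEquiv`, as in `HarishChandraGLParameterOfCharacter`). -/
local notation "toTop" =>
  (LieEquiv.toLieHom (LieEquiv.symm (LieSubalgebra.topEquiv :
    (⊤ : LieSubalgebra ℝ (Matrix (Fin n) (Fin n) (mixedSpace K))) ≃ₗ⁅ℝ⁆
      Matrix (Fin n) (Fin n) (mixedSpace K))))

/-! ### The factor `𝔤𝔩ₙ(ℂ) = 𝔤𝔩ₙ(K_w) ↪ 𝔤 = Lie(GLₙ(K_∞))` at a complex place -/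

/-- **`φ_w : 𝔤𝔩ₙ(ℂ) = 𝔤𝔩ₙ(K_w) ↪ 𝔤`**, the inclusion of the factor at the complex place `w` into the
Lie algebra of `G_∞ = GLₙ(K_∞)` (`complexPlaceLie` followed by `⊤ ≅ 𝔤𝔩ₙ(K_∞)`; the form in which the
place factors enter `HasArchParameter`). [cite: Clozel1990, §3.3] -/
def placeLie : Matrix (Fin n) (Fin n) ℂ →ₗ⁅ℝ⁆ (archGroupGL n K).lie :=
  LieHom.comp toTop (complexPlaceLie n w)

/-- The underlying matrix of `φ_w Y`. [folklore] -/
@[simp] theorem coe_placeLie (Y : Matrix (Fin n) (Fin n) ℂ) :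
    ((placeLie n w Y : (archGroupGL n K).lie) : Matrix (Fin n) (Fin n) (mixedSpace K)) =
      complexPlaceLie n w Y := rfl

/-- `(ρ ∘ toTop) ∘ complexPlaceLie = ρ ∘ φ_w` (the restriction appearing in `HasArchParameter`).
[folklore] -/
theorem comp_comp_complexPlaceLie {M : Type*} [LieRing M] [LieAlgebra ℝ M]
    (ρ : (archGroupGL n K).lie →ₗ⁅ℝ⁆ M) :
    (ρ.comp toTop).comp (complexPlaceLie n w) = ρ.comp (placeLie n w) := rfl

omit [NumberField K] in
/-- `M · φ_w(Y) = φ_w(M_w Y)`: only the `w`-component `M_w` of `M ∈ 𝔤𝔩ₙ(K_∞)` sees the factor.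
[folklore] -/
theorem mul_complexPlaceLie (M : Matrix (Fin n) (Fin n) (mixedSpace K)) (Y : Matrix (Fin n) (Fin n) ℂ) :
    M * complexPlaceLie n w Y = complexPlaceLie n w (M.map (fun a => a.2 w) * Y) := by
  refine Matrix.ext fun i j => Prod.ext ?_ (funext fun v => ?_)
  · simp [Matrix.mul_apply, complexPlaceLie_apply, Prod.fst_sum]
  · simp only [Matrix.mul_apply, complexPlaceLie_apply, Matrix.map_apply, Prod.snd_sum, Prod.snd_mul,
      Finset.sum_apply, Pi.mul_apply]
    by_cases hv : v = w
    · subst hv; simp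
    · simp [Pi.single_eq_of_ne hv]

omit [NumberField K] in
/-- `φ_w(Y) · M = φ_w(Y M_w)`. [folklore] -/
theorem complexPlaceLie_mul (M : Matrix (Fin n) (Fin n) (mixedSpace K)) (Y : Matrix (Fin n) (Fin n) ℂ) :
    complexPlaceLie n w Y * M = complexPlaceLie n w (Y * M.map (fun a => a.2 w)) := by
  refine Matrix.ext fun i j => Prod.ext ?_ (funext fun v => ?_)
  · simp [Matrix.mul_apply, complexPlaceLie_apply, Prod.fst_sum]
  · simp only [Matrix.mul_apply, complexPlaceLie_apply, Matrix.map_apply, Prod.snd_sum, Prod.snd_mul,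
      Finset.sum_apply, Pi.mul_apply]
    by_cases hv : v = w
    · subst hv; simp
    · simp [Pi.single_eq_of_ne hv]

omit [NumberField K] in
/-- The `w`-component of `φ_w(Y)` is `Y`. [folklore] -/
@[simp] theorem map_snd_complexPlaceLie (Y : Matrix (Fin n) (Fin n) ℂ) :
    (complexPlaceLie n w Y).map (fun a => a.2 w) = Y := by
  ext i j
  simp [complexPlaceLie_apply]

/-- **`[X, φ_w Y] = φ_w [X_w, Y]`** for every `X ∈ 𝔤`. [folklore] -/
theorem lie_placeLie (X : (archGroupGL n K).lie) (Y : Matrix (Fin n) (Fin n) ℂ) :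
    ⁅X, placeLie n w Y⁆ =
      placeLie n w ⁅(X : Matrix (Fin n) (Fin n) (mixedSpace K)).map (fun a => a.2 w), Y⁆ := by
  apply Subtype.ext
  rw [LieSubalgebra.coe_bracket, coe_placeLie, coe_placeLie, Ring.lie_def, Ring.lie_def,
    mul_complexPlaceLie, complexPlaceLie_mul, map_sub]

/-- `[φ_w Y, φ_w Y'] = φ_w [Y, Y']` (`φ_w` is a Lie algebra morphism; restated). [folklore] -/
theorem placeLie_lie (Y Y' : Matrix (Fin n) (Fin n) ℂ) :
    ⁅placeLie n w Y, placeLie n w Y'⁆ = placeLie n w ⁅Y, Y'⁆ :=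
  (LieHom.map_lie _ Y Y').symm

/-- Evaluation `GLₙ(K_∞) → GLₙ(K_w) = GLₙ(ℂ)` at the complex place `w`. [folklore] -/
def evalGL : GL (Fin n) (mixedSpace K) →* GL (Fin n) ℂ :=
  Matrix.GeneralLinearGroup.map ((evalComplexAlgHom K w : mixedSpace K →ₐ[ℝ] ℂ) : mixedSpace K →+* ℂ)

omit [NumberField K] in
/-- The underlying matrix of `evalGL`. [folklore] -/
theorem coe_evalGL (g : GL (Fin n) (mixedSpace K)) :
    ((evalGL n w g : GL (Fin n) ℂ) : Matrix (Fin n) (Fin n) ℂ) =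
      (g : Matrix (Fin n) (Fin n) (mixedSpace K)).map (fun a => a.2 w) := rfl

/-- **`Ad(g) φ_w(Y) = φ_w(g_w Y g_w⁻¹)`.** [folklore] -/
theorem Ad_placeLie (g : (archGroupGL n K).carrier) (Y : Matrix (Fin n) (Fin n) ℂ) :
    (archGroupGL n K).Ad g (placeLie n w Y) =
      placeLie n w (adEquiv (evalGL n w (g : GL (Fin n) (mixedSpace K))) Y) := by
  apply Subtype.ext
  rw [RealMatrixGroup.Ad_apply_coe, coe_placeLie, coe_placeLie, adEquiv_apply, mul_complexPlaceLie,
    complexPlaceLie_mul, ← map_inv (evalGL n w)]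
  rfl


/-! ### `GLₙ(ℂ) = GLₙ(K_w) ↪ G_∞`: the element `g` at the place `w`, `1` at the other places -/

omit [NumberField K] in
/-- The matrix `1 + φ_w(g - 1) ∈ 𝔤𝔩ₙ(K_∞)`: `g` in the factor at `w`, the identity elsewhere. [folklore] -/
theorem placeMat_mul (g h : Matrix (Fin n) (Fin n) ℂ) :
    (1 + complexPlaceLie n w (g - 1)) * (1 + complexPlaceLie n w (h - 1)) =
      1 + complexPlaceLie n w (g * h - 1) := by
  rw [add_mul, one_mul, mul_add, mul_one, complexPlaceLie_mul, map_snd_complexPlaceLie, add_assoc,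
    ← map_add, ← map_add]
  congr 2
  noncomm_ring

omit [NumberField K] in
/-- The `w`-component of `1 + φ_w(g - 1)` is `g`. [folklore] -/
theorem map_snd_placeMat (g : Matrix (Fin n) (Fin n) ℂ) :
    (1 + complexPlaceLie n w (g - 1) : Matrix (Fin n) (Fin n) (mixedSpace K)).map (fun a => a.2 w) = g := by
  ext i j
  simp only [Matrix.map_apply, Matrix.add_apply, complexPlaceLie_apply, Matrix.sub_apply, Matrix.one_apply,
    Prod.snd_add, Pi.add_apply, Pi.single_eq_same]
  split_ifs <;> simp

/-- **`ι_w : GLₙ(ℂ) → G_∞ = GLₙ(K_∞)`**, `g ↦ (1, …, g, …, 1)` (`g` at the complex place `w`). [folklore] -/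
def placeGL (g : GL (Fin n) ℂ) : (archGroupGL n K).carrier :=
  ⟨⟨1 + complexPlaceLie n w ((g : Matrix (Fin n) (Fin n) ℂ) - 1),
    1 + complexPlaceLie n w (((g⁻¹ : GL (Fin n) ℂ) : Matrix (Fin n) (Fin n) ℂ) - 1),
    by rw [placeMat_mul, ← Units.val_mul, mul_inv_cancel, Units.val_one, sub_self, map_zero, add_zero],
    by rw [placeMat_mul, ← Units.val_mul, inv_mul_cancel, Units.val_one, sub_self, map_zero, add_zero]⟩,
    Subgroup.mem_top _⟩

/-- The underlying matrix of `ι_w(g)`. [folklore] -/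
theorem coe_placeGL (g : GL (Fin n) ℂ) :
    (((placeGL n w g : (archGroupGL n K).carrier) : GL (Fin n) (mixedSpace K)) : Matrix (Fin n) (Fin n) (mixedSpace K)) =
      1 + complexPlaceLie n w ((g : Matrix (Fin n) (Fin n) ℂ) - 1) := rfl

/-- `ev_w ∘ ι_w = id`. [folklore] -/
theorem evalGL_placeGL (g : GL (Fin n) ℂ) :
    evalGL n w ((placeGL n w g : (archGroupGL n K).carrier) : GL (Fin n) (mixedSpace K)) = g :=
  Units.ext (by rw [coe_evalGL, coe_placeGL, map_snd_placeMat])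

/-- **`Ad(ι_w g) φ_w(Y) = φ_w(g Y g⁻¹)`.** [folklore] -/
theorem Ad_placeGL_placeLie (g : GL (Fin n) ℂ) (Y : Matrix (Fin n) (Fin n) ℂ) :
    (archGroupGL n K).Ad (placeGL n w g) (placeLie n w Y) =
      placeLie n w ((g : Matrix (Fin n) (Fin n) ℂ) * Y * ((g⁻¹ : GL (Fin n) ℂ) : Matrix (Fin n) (Fin n) ℂ)) := by
  rw [Ad_placeLie, evalGL_placeGL, adEquiv_apply]

/-! ### The canonical tensors of `B₊`, `B₋` pushed to the place `w` -/

/-- The family `φ_w(b_x)`, `b_x` the real basis `{E_{ab}, iE_{ab}}` of `𝔤𝔩ₙ(ℂ)`. [folklore] -/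
def yB (x : Fin 2 × (Fin n × Fin n)) : (archGroupGL n K).lie := placeLie n w (cplxBasis n x)

/-- The family `φ_w(b_x^∨)` of `B₊`-duals. [folklore] -/
def yRe (x : Fin 2 × (Fin n × Fin n)) : (archGroupGL n K).lie :=
  placeLie n w ((reTraceForm n).dualBasis (reTraceForm_nondegenerate n) (cplxBasis n) x)

/-- The family `φ_w(b_x^∨)` of `B₋`-duals. [folklore] -/
def yIm (x : Fin 2 × (Fin n × Fin n)) : (archGroupGL n K).lie :=
  placeLie n w ((imTraceForm n).dualBasis (imTraceForm_nondegenerate n) (cplxBasis n) x)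

/-- `φ_w` as a real-linear map (for `TensorProduct.map`). [folklore] -/
abbrev placeLin : Matrix (Fin n) (Fin n) ℂ →ₗ[ℝ] (archGroupGL n K).lie :=
  ((placeLie n w : Matrix (Fin n) (Fin n) ℂ →ₗ⁅ℝ⁆ (archGroupGL n K).lie) :
    Matrix (Fin n) (Fin n) ℂ →ₗ[ℝ] (archGroupGL n K).lie)

/-- Push-forward of a sum of tensors along `φ_w ⊗ φ_w`. [folklore] -/
theorem map_sum_tmul {ι : Type*} (S : Finset ι) (f g : ι → Matrix (Fin n) (Fin n) ℂ) :
    TensorProduct.map (placeLin n w) (placeLin n w) (∑ x ∈ S, f x ⊗ₜ[ℝ] g x) =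
      ∑ x ∈ S, placeLie n w (f x) ⊗ₜ[ℝ] placeLie n w (g x) := by
  rw [map_sum]
  exact Finset.sum_congr rfl fun x _ => by rw [TensorProduct.map_tmul]; rfl

/-- Push-forward of a sum of pairs of tensors along `φ_w ⊗ φ_w`. [folklore] -/
theorem map_sum_tmul_add_tmul {ι : Type*} (S : Finset ι) (f g f' g' : ι → Matrix (Fin n) (Fin n) ℂ) :
    TensorProduct.map (placeLin n w) (placeLin n w) (∑ x ∈ S, (f x ⊗ₜ[ℝ] g x + f' x ⊗ₜ[ℝ] g' x)) =
      ∑ x ∈ S, (placeLie n w (f x) ⊗ₜ[ℝ] placeLie n w (g x) +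
        placeLie n w (f' x) ⊗ₜ[ℝ] placeLie n w (g' x)) := by
  rw [map_sum]
  exact Finset.sum_congr rfl fun x _ => by rw [map_add, TensorProduct.map_tmul, TensorProduct.map_tmul]; rfl

/-- **`𝔤`-invariance of `∑ φ_w(b_x) ⊗ φ_w(b_x^∨)` (`B₊`).** [cite: Knapp2002, §V.4 Prop. 5.24] -/
theorem sum_lie_yB_tmul_yRe (X : (archGroupGL n K).lie) :
    ∑ x, (⁅X, yB n w x⁆ ⊗ₜ[ℝ] yRe n w x + yB n w x ⊗ₜ[ℝ] ⁅X, yRe n w x⁆) =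
      (0 : (archGroupGL n K).lie ⊗[ℝ] (archGroupGL n K).lie) := by
  simp only [yB, yRe, lie_placeLie]
  have h := congrArg (TensorProduct.map (placeLin n w) (placeLin n w))
    (sum_lie_cplxBasis_tmul_dualRe ((X : Matrix (Fin n) (Fin n) (mixedSpace K)).map fun a => a.2 w))
  rw [map_sum_tmul_add_tmul, map_zero] at h
  exact h

/-- **`𝔤`-invariance of `∑ φ_w(b_x) ⊗ φ_w(b_x^∨)` (`B₋`).** [cite: Knapp2002, §V.4 Prop. 5.24] -/
theorem sum_lie_yB_tmul_yIm (X : (archGroupGL n K).lie) :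
    ∑ x, (⁅X, yB n w x⁆ ⊗ₜ[ℝ] yIm n w x + yB n w x ⊗ₜ[ℝ] ⁅X, yIm n w x⁆) =
      (0 : (archGroupGL n K).lie ⊗[ℝ] (archGroupGL n K).lie) := by
  simp only [yB, yIm, lie_placeLie]
  have h := congrArg (TensorProduct.map (placeLin n w) (placeLin n w))
    (sum_lie_cplxBasis_tmul_dualIm ((X : Matrix (Fin n) (Fin n) (mixedSpace K)).map fun a => a.2 w))
  rw [map_sum_tmul_add_tmul, map_zero] at h
  exact h

/-- **`Ad(G_∞)`-invariance of `∑ φ_w(b_x) ⊗ φ_w(b_x^∨)` (`B₊`).** [cite: Knapp2002, §V.4 Prop. 5.24] -/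
theorem sum_Ad_yB_tmul_Ad_yRe (g : (archGroupGL n K).carrier) :
    ∑ x, (archGroupGL n K).Ad g (yB n w x) ⊗ₜ[ℝ] (archGroupGL n K).Ad g (yRe n w x) =
      ∑ x, yB n w x ⊗ₜ[ℝ] yRe n w x := by
  simp only [yB, yRe, Ad_placeLie]
  have h := congrArg (TensorProduct.map (placeLin n w) (placeLin n w))
    (sum_adEquiv_cplxBasis_tmul_adEquiv_dualRe (evalGL n w (g : GL (Fin n) (mixedSpace K))))
  rw [map_sum_tmul, map_sum_tmul] at h
  exact h

/-- **`Ad(G_∞)`-invariance of `∑ φ_w(b_x) ⊗ φ_w(b_x^∨)` (`B₋`).** [cite: Knapp2002, §V.4 Prop. 5.24] -/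
theorem sum_Ad_yB_tmul_Ad_yIm (g : (archGroupGL n K).carrier) :
    ∑ x, (archGroupGL n K).Ad g (yB n w x) ⊗ₜ[ℝ] (archGroupGL n K).Ad g (yIm n w x) =
      ∑ x, yB n w x ⊗ₜ[ℝ] yIm n w x := by
  simp only [yB, yIm, Ad_placeLie]
  have h := congrArg (TensorProduct.map (placeLin n w) (placeLin n w))
    (sum_adEquiv_cplxBasis_tmul_adEquiv_dualIm (evalGL n w (g : GL (Fin n) (mixedSpace K))))
  rw [map_sum_tmul, map_sum_tmul] at h
  exact h

/-- Symmetry of `∑ φ_w(b_x) ⊗ φ_w(b_x^∨)` (`B₊`). [folklore] -/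
theorem sum_yRe_tmul_yB : ∑ x, yRe n w x ⊗ₜ[ℝ] yB n w x = ∑ x, yB n w x ⊗ₜ[ℝ] yRe n w x := by
  simp only [yB, yRe]
  have h := congrArg (TensorProduct.map (placeLin n w) (placeLin n w)) (sum_dualRe_tmul_cplxBasis (n := n))
  rw [map_sum_tmul, map_sum_tmul] at h
  exact h

/-- Symmetry of `∑ φ_w(b_x) ⊗ φ_w(b_x^∨)` (`B₋`). [folklore] -/
theorem sum_yIm_tmul_yB : ∑ x, yIm n w x ⊗ₜ[ℝ] yB n w x = ∑ x, yB n w x ⊗ₜ[ℝ] yIm n w x := by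
  simp only [yB, yIm]
  have h := congrArg (TensorProduct.map (placeLin n w) (placeLin n w)) (sum_dualIm_tmul_cplxBasis (n := n))
  rw [map_sum_tmul, map_sum_tmul] at h
  exact h

/-! ### The operators: `∑ ρ(φ_w b_x) ρ(φ_w b_x^∨) = ρ_w(C_±)`, and the centre `φ_w(u · 1)` -/

section Operators

variable {V : Type*} [AddCommGroup V] [Module ℂ V] (ρ𝔤 : (archGroupGL n K).lie →ₗ⁅ℝ⁆ Module.End ℂ V)

/-- **`∑_x ρ(φ_w b_x) ρ(φ_w b_x^∨) = ρ_w(C₊)`**, `ρ_w = ρ ∘ φ_w`. [cite: Knapp2002, §V.4 (5.24)] -/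
theorem op_yB_yRe : GKCasimir.op (archGroupGL n K) ρ𝔤 (yB n w) (yRe n w) =
    lift ℝ (ρ𝔤.comp (placeLie n w)) (casPlus n) := by
  rw [GKCasimir.op, ← sum_rho_cplxBasis_mul_rho_dualRe (ρ𝔤.comp (placeLie n w))]
  rfl

/-- **`∑_x ρ(φ_w b_x) ρ(φ_w b_x^∨) = ρ_w(C₋)`** for the `B₋`-duals. [cite: Knapp2002, §V.4 (5.24)] -/
theorem op_yB_yIm : GKCasimir.op (archGroupGL n K) ρ𝔤 (yB n w) (yIm n w) =
    lift ℝ (ρ𝔤.comp (placeLie n w)) (casMinus n) := by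
  rw [GKCasimir.op, ← sum_rho_cplxBasis_mul_rho_dualIm (ρ𝔤.comp (placeLie n w))]
  rfl

/-- **The central elements `Z_w(u) = φ_w(u · 1)` of `𝔤`**, `u ∈ ℂ`. [folklore] -/
def zed (u : ℂ) : (archGroupGL n K).lie := placeLie n w (u • (1 : Matrix (Fin n) (Fin n) ℂ))

/-- `Z_w(u)` is central in `𝔤`. [folklore] -/
theorem zed_lie (u : ℂ) (X : (archGroupGL n K).lie) : ⁅zed n w u, X⁆ = 0 := by
  rw [← lie_skew, zed, lie_placeLie, neg_eq_zero, Ring.lie_def, Matrix.mul_smul, Matrix.mul_one,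
    Matrix.smul_mul, Matrix.one_mul, sub_self, map_zero]

/-- `Z_w(u)` is `Ad(G_∞)`-fixed. [folklore] -/
theorem Ad_zed (g : (archGroupGL n K).carrier) (u : ℂ) : (archGroupGL n K).Ad g (zed n w u) = zed n w u := by
  rw [zed, Ad_placeLie, adEquiv_apply, Matrix.mul_smul, Matrix.mul_one, Matrix.smul_mul, ← Units.val_mul,
    mul_inv_cancel, Units.val_one]

/-- `ρ(Z_w(u)) = ρ_w(Z(u))`, `Z(u) = ι(u · 1) ∈ U_ℝ(𝔤𝔩ₙ(ℂ))` (`zedU`). [folklore] -/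
theorem rho_zed (u : ℂ) : ρ𝔤 (zed n w u) = lift ℝ (ρ𝔤.comp (placeLie n w)) (zedU n u) := by
  rw [zedU, lift_ι_apply]
  rfl

/-- `ρ_w` maps the centre of `U_ℝ(𝔤𝔩ₙ(ℂ))` to the centre of `U(𝔤)` acting through `ρ`: a central
character `θ` of `ρ` restricts to a central character of `ρ_w` (`HasCentralCharacter.exists_comp`,
`lift_complexPlaceLie_mem_center`). [cite: Knapp2002, §V.5 Thm. 5.44] -/
theorem exists_hasCentralCharacter_comp_placeLie
    {θ : Subalgebra.center ℝ (UniversalEnvelopingAlgebra ℝ (archGroupGL n K).lie) →ₐ[ℝ] ℂ}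
    (hθ : HasCentralCharacter ρ𝔤 θ) :
    ∃ θ₁ : Subalgebra.center ℝ (UniversalEnvelopingAlgebra ℝ (Matrix (Fin n) (Fin n) ℂ)) →ₐ[ℝ] ℂ,
      HasCentralCharacter (ρ𝔤.comp (placeLie n w)) θ₁ :=
  hθ.exists_comp (placeLie n w) (fun _ hz => lift_complexPlaceLie_mem_center w hz)

/-- A central element of `U_ℝ(𝔤𝔩ₙ(ℂ))` acts through `ρ_w` by a scalar when `ρ` has a central
character. [cite: Knapp2002, §V.5 Thm. 5.44] -/
theorem exists_lift_eq_smul_of_hasCentralCharacter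
    {θ : Subalgebra.center ℝ (UniversalEnvelopingAlgebra ℝ (archGroupGL n K).lie) →ₐ[ℝ] ℂ}
    (hθ : HasCentralCharacter ρ𝔤 θ) {z : UniversalEnvelopingAlgebra ℝ (Matrix (Fin n) (Fin n) ℂ)}
    (hz : z ∈ Subalgebra.center ℝ (UniversalEnvelopingAlgebra ℝ (Matrix (Fin n) (Fin n) ℂ))) :
    ∃ c : ℂ, ∀ v : V, lift ℝ (ρ𝔤.comp (placeLie n w)) z v = c • v := by
  obtain ⟨θ₁, hθ₁⟩ := exists_hasCentralCharacter_comp_placeLie n w ρ𝔤 hθ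
  refine ⟨θ₁ ⟨z, hz⟩, fun v => ?_⟩
  have h := hθ₁ ⟨z, hz⟩
  rw [h]
  rfl

end Operators

/-! ### Consequences for `(𝔤, K_∞)`-cohomology: the scalars of `C_±`, `Z(u)` on the two factors -/

section Cohomology

variable {V : Type*} [AddCommGroup V] [Module ℂ V]
  (ρK : Representation ℂ (archGroupGL n K).maximalCompact V)
  (ρ𝔤 : (archGroupGL n K).lie →ₗ⁅ℝ⁆ Module.End ℂ V)
  (hV : ∀ (k : (archGroupGL n K).maximalCompact) (X : (archGroupGL n K).lie),
    ρK k ∘ₗ ρ𝔤 X ∘ₗ ρK k⁻¹ =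
      ρ𝔤 ((archGroupGL n K).Ad (Subgroup.inclusion (archGroupGL n K).maximalCompact_le_carrier k) X))
  {W : Type*} [AddCommGroup W] [Module ℂ W]
  (σK : Representation ℂ (archGroupGL n K).maximalCompact W)
  (σ𝔤 : (archGroupGL n K).lie →ₗ⁅ℝ⁆ Module.End ℂ W)
  (hW : ∀ (k : (archGroupGL n K).maximalCompact) (X : (archGroupGL n K).lie),
    σK k ∘ₗ σ𝔤 X ∘ₗ σK k⁻¹ =
      σ𝔤 ((archGroupGL n K).Ad (Subgroup.inclusion (archGroupGL n K).maximalCompact_le_carrier k) X))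

/-- **`H^q(𝔤, K_∞; V ⊗ W) ≠ 0` forces `C₊,w` to act on `V` and `W` by the same scalar** (when it acts
by scalars on both). [cite: BorelWallach2000, I §4.1 and §5.3] -/
theorem casPlus_scalar_eq_of_cohomology_ne_zero {c c' : ℂ}
    (hc : ∀ v : V, lift ℝ (ρ𝔤.comp (placeLie n w)) (casPlus n) v = c • v)
    (hc' : ∀ e : W, lift ℝ (σ𝔤.comp (placeLie n w)) (casPlus n) e = c' • e) (q : ℕ)
    (hx : ∃ x : GKTensor.cohomology (archGroupGL n K) ρK ρ𝔤 σK σ𝔤 hV hW q, x ≠ 0) : c = c' :=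
  GKTensor.casimir_scalar_eq_of_cohomology_ne_zero (archGroupGL n K) ρK ρ𝔤 hV (yB n w) (yRe n w) σK σ𝔤
    hW (sum_lie_yB_tmul_yRe n w) (fun k => sum_Ad_yB_tmul_Ad_yRe n w _) (sum_yRe_tmul_yB n w)
    (fun v => by rw [op_yB_yRe]; exact hc v) (fun e => by rw [op_yB_yRe]; exact hc' e) q hx

/-- **The same for `C₋,w`.** [cite: BorelWallach2000, I §4.1 and §5.3] -/
theorem casMinus_scalar_eq_of_cohomology_ne_zero {c c' : ℂ}
    (hc : ∀ v : V, lift ℝ (ρ𝔤.comp (placeLie n w)) (casMinus n) v = c • v)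
    (hc' : ∀ e : W, lift ℝ (σ𝔤.comp (placeLie n w)) (casMinus n) e = c' • e) (q : ℕ)
    (hx : ∃ x : GKTensor.cohomology (archGroupGL n K) ρK ρ𝔤 σK σ𝔤 hV hW q, x ≠ 0) : c = c' :=
  GKTensor.casimir_scalar_eq_of_cohomology_ne_zero (archGroupGL n K) ρK ρ𝔤 hV (yB n w) (yIm n w) σK σ𝔤
    hW (sum_lie_yB_tmul_yIm n w) (fun k => sum_Ad_yB_tmul_Ad_yIm n w _) (sum_yIm_tmul_yB n w)
    (fun v => by rw [op_yB_yIm]; exact hc v) (fun e => by rw [op_yB_yIm]; exact hc' e) q hx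

/-- **`H^q(𝔤, K_∞; V ⊗ W) ≠ 0` forces `Z_w(u)` to act on `V` and `W` by opposite scalars.**
[cite: BorelWallach2000, I §4.1 and §5.3] -/
theorem zedU_scalar_add_eq_zero_of_cohomology_ne_zero (u : ℂ) {c c' : ℂ}
    (hc : ∀ v : V, lift ℝ (ρ𝔤.comp (placeLie n w)) (zedU n u) v = c • v)
    (hc' : ∀ e : W, lift ℝ (σ𝔤.comp (placeLie n w)) (zedU n u) e = c' • e) (q : ℕ)
    (hx : ∃ x : GKTensor.cohomology (archGroupGL n K) ρK ρ𝔤 σK σ𝔤 hV hW q, x ≠ 0) : c + c' = 0 :=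
  GKTensor.central_scalar_add_eq_zero_of_cohomology_ne_zero (archGroupGL n K) ρK ρ𝔤 hV σK σ𝔤 hW
    (zed_lie n w u) (fun k => Ad_zed n w _ u)
    (fun v => by rw [rho_zed]; exact hc v) (fun e => by rw [rho_zed]; exact hc' e) q hx

end Cohomology

end ComplexPlace

end Literature.NumberTheory.Automorphic

end
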